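import Summits.Ventures.Crystal3D.Theorems.StickyWulffConstantTextureLiminfTexShadowDefs

/-!
# Sheared prisms over a planar face: `|F + [0,1]·a| = |⟪a, ν⟫| · |F + [0,1]·ν|` (conversion of the
# `w`-shadow of a wall face to its facet area; for the general single-axis rung of
# `PolycrystalWulffBound`, line `PolyDensity`, crux `stmt-Ventures-19482`)

Route `StickyWulffConstant` of the venture `Summits/Ventures/Crystal3D`, second prover lane (poly-p2,
gen 10).  The tree measures a planar facet `F ⊆ {⟪ν, x⟫ = b}` by the volume of the unit prism
`F + [0,1]·ν` (`facetArea F ν`, `…TexShadowDefs`).  The line-of-sight trimming of the general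
single-axis rung (`…LineTrim`, p637101) produces instead the SHADOW of `F` along the fibre direction
`w`, i.e. the volume of the sheared prism `F + [0,1]·w`.  The affine shear
`x ↦ x + (⟪ν, x⟫ − b)·(a − ν)` fixes the plane pointwise, maps `F + [0,1]·ν` onto `F + [0,1]·a`, and
has determinant `⟪a, ν⟫` (rank-one update of the identity), whence
`volume (F + [0,1]·a) = |⟪a, ν⟫| · volume (F + [0,1]·ν)` (`volume_prism_shear`), in particular
`≤ volume (F + [0,1]·ν)` for a unit `a` (`volume_prism_shear_le`).
WHAT THIS IS NOT: anything about lattices; the rung is a separate file; the crux is not claimed.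
-/

noncomputable section

open scoped BigOperators InnerProductSpace ENNReal
open MeasureTheory Set

namespace Summit.Ventures.Crystal3D.Theorems

open Summit.Ventures.Crystal3D.Cruxes.TextureLiminf.TexShadow (E3)

/-- The shear `x ↦ x + ⟪ν, x⟫·(a − ν)` as a linear map. -/
private theorem shear_apply (ν a x : E3) :
    (LinearMap.id + (innerₛₗ ℝ ν).smulRight (a - ν) : E3 →ₗ[ℝ] E3) x = x + ⟪ν, x⟫_ℝ • (a - ν) := rfl

/-- **Determinant of the shear**: `det (x ↦ x + ⟪ν, x⟫·(a − ν)) = ⟪a, ν⟫` for a unit `ν`. -/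
theorem det_shear {ν : E3} (hν : ‖ν‖ = 1) (a : E3) :
    LinearMap.det (LinearMap.id + (innerₛₗ ℝ ν).smulRight (a - ν) : E3 →ₗ[ℝ] E3) = ⟪a, ν⟫_ℝ := by
  classical
  set L : E3 →ₗ[ℝ] E3 := LinearMap.id + (innerₛₗ ℝ ν).smulRight (a - ν) with hL
  set bs := (EuclideanSpace.basisFun (Fin 3) ℝ).toBasis with hbs
  have hent : ∀ i j : Fin 3, LinearMap.toMatrix bs bs L i j =
      (if i = j then 1 else 0) + ν j * (a i - ν i) := by
    intro i j
    rw [LinearMap.toMatrix_apply, hbs, OrthonormalBasis.coe_toBasis_repr_apply,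
      EuclideanSpace.basisFun_repr, OrthonormalBasis.coe_toBasis, EuclideanSpace.basisFun_apply, hL,
      shear_apply, EuclideanSpace.inner_single_right]
    simp only [PiLp.add_apply, PiLp.smul_apply, PiLp.sub_apply, smul_eq_mul,
      PiLp.single_apply]
    by_cases hij : i = j
    · subst hij; simp
    · simp [hij]
  have hn : ν 0 ^ 2 + ν 1 ^ 2 + ν 2 ^ 2 = 1 := by
    have h := hν
    rw [EuclideanSpace.norm_eq, Real.sqrt_eq_one, Fin.sum_univ_three] at h
    simpa only [Real.norm_eq_abs, sq_abs] using h
  have hin : ⟪a, ν⟫_ℝ = a 0 * ν 0 + a 1 * ν 1 + a 2 * ν 2 := by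
    simp [PiLp.inner_apply, Fin.sum_univ_three, mul_comm]
  have h00 : LinearMap.toMatrix bs bs L 0 0 = 1 + ν 0 * (a 0 - ν 0) := by rw [hent]; simp
  have h11 : LinearMap.toMatrix bs bs L 1 1 = 1 + ν 1 * (a 1 - ν 1) := by rw [hent]; simp
  have h22 : LinearMap.toMatrix bs bs L 2 2 = 1 + ν 2 * (a 2 - ν 2) := by rw [hent]; simp
  have h01 : LinearMap.toMatrix bs bs L 0 1 = ν 1 * (a 0 - ν 0) := by rw [hent]; simp
  have h02 : LinearMap.toMatrix bs bs L 0 2 = ν 2 * (a 0 - ν 0) := by rw [hent]; simp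
  have h10 : LinearMap.toMatrix bs bs L 1 0 = ν 0 * (a 1 - ν 1) := by rw [hent]; simp
  have h12 : LinearMap.toMatrix bs bs L 1 2 = ν 2 * (a 1 - ν 1) := by rw [hent]; simp
  have h20 : LinearMap.toMatrix bs bs L 2 0 = ν 0 * (a 2 - ν 2) := by rw [hent]; simp
  have h21 : LinearMap.toMatrix bs bs L 2 1 = ν 1 * (a 2 - ν 2) := by rw [hent]; simp
  rw [← LinearMap.det_toMatrix bs, Matrix.det_fin_three, h00, h01, h02, h10, h11, h12, h20, h21, h22,
    hin]
  linear_combination (-1 : ℝ) * hn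

/-- **Sheared prisms over a planar set**: for `F ⊆ {⟪ν, x⟫ = b}` (`‖ν‖ = 1`) and any vector `a`,
`volume (F + [0,1]·a) = |⟪a, ν⟫| · volume (F + [0,1]·ν)`. -/
theorem volume_prism_shear (F : Set E3) {ν : E3} (hν : ‖ν‖ = 1) {b : ℝ}
    (hF : F ⊆ {x : E3 | ⟪ν, x⟫_ℝ = b}) (a : E3) :
    volume {x : E3 | ∃ y ∈ F, ∃ t ∈ Icc (0 : ℝ) 1, x = y + t • a} =
      ENNReal.ofReal |⟪a, ν⟫_ℝ| * volume {x : E3 | ∃ y ∈ F, ∃ t ∈ Icc (0 : ℝ) 1, x = y + t • ν} := by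
  set L : E3 →ₗ[ℝ] E3 := LinearMap.id + (innerₛₗ ℝ ν).smulRight (a - ν) with hL
  have hLapply : ∀ x, L x = x + ⟪ν, x⟫_ℝ • (a - ν) := fun x => shear_apply ν a x
  have hνν : ⟪ν, ν⟫_ℝ = 1 := by rw [real_inner_self_eq_norm_sq, hν, one_pow]
  -- the shear maps the straight prism onto the sheared one, up to the translation by `b·(a − ν)`
  have hmap : ∀ y ∈ F, ∀ t : ℝ, L (y + t • ν) = y + t • a + b • (a - ν) := by
    intro y hy t
    have hyb : ⟪ν, y⟫_ℝ = b := hF hy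
    rw [hLapply, inner_add_right, hyb, real_inner_smul_right, hνν, mul_one]
    module
  have himage : {x : E3 | ∃ y ∈ F, ∃ t ∈ Icc (0 : ℝ) 1, x = y + t • a} =
      (fun x => x + b • (a - ν)) ⁻¹' (L '' {x : E3 | ∃ y ∈ F, ∃ t ∈ Icc (0 : ℝ) 1, x = y + t • ν}) := by
    ext x
    simp only [mem_setOf_eq, mem_preimage, mem_image]
    constructor
    · rintro ⟨y, hy, t, ht, rfl⟩
      exact ⟨y + t • ν, ⟨y, hy, t, ht, rfl⟩, hmap y hy t⟩
    · rintro ⟨z, ⟨y, hy, t, ht, rfl⟩, hz⟩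
      refine ⟨y, hy, t, ht, ?_⟩
      rw [hmap y hy t] at hz
      exact (add_right_cancel hz).symm
  rw [himage, measure_preimage_add_right, MeasureTheory.Measure.addHaar_image_linearMap, det_shear hν a]

/-- **The shadow is at most the area**: for a unit `a`, `volume (F + [0,1]·a) ≤ volume (F + [0,1]·ν)`. -/
theorem volume_prism_shear_le (F : Set E3) {ν : E3} (hν : ‖ν‖ = 1) {b : ℝ}
    (hF : F ⊆ {x : E3 | ⟪ν, x⟫_ℝ = b}) {a : E3} (ha : ‖a‖ = 1) :
    volume {x : E3 | ∃ y ∈ F, ∃ t ∈ Icc (0 : ℝ) 1, x = y + t • a} ≤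
      volume {x : E3 | ∃ y ∈ F, ∃ t ∈ Icc (0 : ℝ) 1, x = y + t • ν} := by
  rw [volume_prism_shear F hν hF a]
  have h1 : |⟪a, ν⟫_ℝ| ≤ 1 := by
    have h := abs_real_inner_le_norm a ν
    rw [ha, hν, one_mul] at h
    exact h
  calc ENNReal.ofReal |⟪a, ν⟫_ℝ| * volume {x : E3 | ∃ y ∈ F, ∃ t ∈ Icc (0 : ℝ) 1, x = y + t • ν}
      ≤ 1 * volume {x : E3 | ∃ y ∈ F, ∃ t ∈ Icc (0 : ℝ) 1, x = y + t • ν} := by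
        gcongr
        rw [← ENNReal.ofReal_one]
        exact ENNReal.ofReal_le_ofReal h1
    _ = _ := one_mul _

end Summit.Ventures.Crystal3D.Theorems

end
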